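import Summits.Parity.BatemanHorn.Theses.VanishingDimension

/-!
# Crux `TiltedLevel` (stmt-Parity-18603) — strategy census: typed signatures

Strategist workfile (planner-cstrat-stmt-Parity-18603-s1-0, 2026-08-17). These are NOT route items
and NOT a skeleton line: they are the Lean signatures referred to in `STRATEGY-CENSUS.md`
(sections Transfer / Strengthen / Decomposition), checked to elaborate against the route file
`Summits/Parity/BatemanHorn/Theses/VanishingDimension.lean`.

* `TiltedLevelAt k f` — the crux body at one system; `tiltedLevel_iff` (by `rfl`).
* Transfer: `TiltedLevelLinearOne` = the `k = 1`, `f = (X)` instance (the solved sibling; provable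
  in-tree from `Literature.NumberTheory.LFunctions.MontgomeryVaughan2007_thm_7_18_holds`).
* Strengthen: `TiltedLevelComplexAt` / `TiltedLevelComplex` — the complex tilt `u ∈ ℂ`,
  `0 < ‖u‖ < z₀`, normalised by the positive mass at `‖u‖`; its `u = -z` slice is the signed tilt.
* Decomposition: `WithinPattern` (parity-neutral: equidistribution among root classes with the same
  local divisibility pattern) and `PatternTotals` (parity-carrying: pattern totals follow `g·S·A₁`);
  `SplitGlue` records the (triangle-inequality) implication to the crux, not proved here because the
  split is not filed (see the census for why).
-/

namespace Summit.Parity.BatemanHorn.Cruxes.TiltedLevel.Census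

open scoped BigOperators Classical
open Filter Asymptotics Finset Polynomial

/-- The crux `TiltedLevel` with the system `(k, f)` fixed (body copied verbatim). -/
def TiltedLevelAt (k : ℕ) (f : Fin k → Polynomial ℤ) : Prop :=
  ∃ θ : ℝ, 0 < θ ∧ θ ≤ 1 / 4 ∧ ∃ z₀ : ℝ, 0 < z₀ ∧ ∀ z : ℝ, 0 < z → z < z₀ → let w : ℕ → ℝ := fun n => z ^ (∑ i, ArithmeticFunction.cardDistinctFactors (((f i).eval (n : ℤ)).toNat)); let A : ℕ → ℕ → ℕ → ℝ := fun x d r => ∑ n ∈ (Finset.Icc 1 x).filter (fun n : ℕ => n ≡ r [MOD d]), w n; let cnt : ℕ → ℕ → ℕ := fun p s => (Finset.univ.filter (fun i => (p : ℤ) ∣ (f i).eval (s : ℤ))).card; let m : ℕ → ℝ := fun p => ∑ s ∈ Finset.range p, z ^ cnt p s; let g : ℕ → ℕ → ℝ := fun d r => ∏ p ∈ d.primeFactors, z ^ cnt p r / m p; let S : ℕ → ℕ → ℕ → ℝ := fun x d r => ∏ i, (1 - (∑ p ∈ d.primeFactors.filter (fun p : ℕ => (p : ℤ) ∣ (f i).eval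 (r : ℤ)), Real.log p) / (((f i).natDegree : ℝ) * Real.log x)) ^ (z - 1); let V : ℕ → ℝ := fun x => ∏ p ∈ (Finset.range ⌊(x : ℝ) ^ θ⌋₊).filter Nat.Prime, ((p : ℝ) - Literature.NumberTheory.Sieve.polyRootCountMod f p) / m p; (fun x : ℕ => ∑ d ∈ (Finset.Icc 1 ⌊(x : ℝ) ^ θ⌋₊).filter Squarefree, ∑ r ∈ (Finset.range d).filter (fun r : ℕ => (d : ℤ) ∣ ∏ i, (f i).eval (r : ℤ)), |A x d r - g d r * S x d r * ∑ n ∈ Finset.Icc 1 x, w n|) =o[atTop] fun x : ℕ => (∑ n ∈ Finset.Icc 1 x, w n) * V x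

/-- `TiltedLevel` is literally `∀ systems, TiltedLevelAt`. -/
theorem tiltedLevel_iff :
    Summit.Parity.BatemanHorn.Theses.VanishingDimension.TiltedLevel ↔
      ∀ (k : ℕ) (f : Fin k → Polynomial ℤ),
        Literature.NumberTheory.Sieve.IsBatemanHornSystem f → TiltedLevelAt k f := by
  rfl

/-! ## Transfer — the solved sibling `k = 1`, `f = (X)` -/

/-- TRANSFER SIBLING. The crux at the single linear polynomial `X`: root class `r = 0` only,
`w(n) = z^{ω(n)}`, `A(x;d,0) = Σ_{m ≤ x/d} z^{ω(dm)}`, `g(d,0) = ∏_{p ∣ d} z/(p-1+z)`,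
`S = (1 - log d/log x)^{z-1}`, `V = ∏_{p<x^θ} (p-1)/(p-1+z)`. Provable now (census §Transfer):
Selberg–Delange `MontgomeryVaughan2007_thm_7_18_holds` for `z^{ω}` + the convolution identity
`1_{(m,d)=1} z^{ω(m)} = Σ_{e ∣ (m, d^∞)} c_d(e) z^{ω(m/e)}` (|c_d| ≤ 1), uniformly in `d ≤ x^{1/4}`. -/
def TiltedLevelLinearOne : Prop := TiltedLevelAt 1 ![(X : Polynomial ℤ)]

/-- The sibling is an instance of the crux (sanity of the typing). -/
theorem tiltedLevelLinearOne_of_tiltedLevel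
    (h : Summit.Parity.BatemanHorn.Theses.VanishingDimension.TiltedLevel)
    (hX : Literature.NumberTheory.Sieve.IsBatemanHornSystem ![(X : Polynomial ℤ)]) :
    TiltedLevelLinearOne :=
  (tiltedLevel_iff.mp h) 1 _ hX

/-! ## Strengthen — the complex tilt `S⁺` -/

/-- STRENGTHEN `S⁺` at one system: the tilt parameter made complex, `u ∈ ℂ`, `0 < ‖u‖ < z₀`;
all model quantities (`m_p`, `g`, `S`) continued holomorphically in `u`, the error measured in `‖·‖`
and normalised by the POSITIVE tilted mass and sifted density at `‖u‖`. At `u = z > 0` it is the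
crux; at `u = -z` it is the relative level law of the SIGNED tilt `(-z)^{Σω(f_i n)}`. -/
def TiltedLevelComplexAt (k : ℕ) (f : Fin k → Polynomial ℤ) : Prop :=
  ∃ θ : ℝ, 0 < θ ∧ θ ≤ 1 / 4 ∧ ∃ z₀ : ℝ, 0 < z₀ ∧ ∀ u : ℂ, 0 < ‖u‖ → ‖u‖ < z₀ → let w : ℕ → ℂ := fun n => u ^ (∑ i, ArithmeticFunction.cardDistinctFactors (((f i).eval (n : ℤ)).toNat)); let wabs : ℕ → ℝ := fun n => ‖u‖ ^ (∑ i, ArithmeticFunction.cardDistinctFactors (((f i).eval (n : ℤ)).toNat)); let A : ℕ → ℕ → ℕ → ℂ := fun x d r => ∑ n ∈ (Finset.Icc 1 x).filter (fun n : ℕ => n ≡ r [MOD d]), w n; let cnt : ℕ → ℕ → ℕ := fun p s => (Finset.univ.filter (fun i => (p : ℤ) ∣ (f i).eval (s : ℤ))).card; let m : ℕ → ℂ := fun p => ∑ s ∈ Finset.range p, u ^ cnt p s; let mabs : ℕ → ℝ := fun p => ∑ s ∈ Finset.range p, ‖u‖ ^ cnt p s; let g : ℕ → ℕ → ℂ :=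 fun d r => ∏ p ∈ d.primeFactors, u ^ cnt p r / m p; let S : ℕ → ℕ → ℕ → ℂ := fun x d r => ∏ i, ((1 - (∑ p ∈ d.primeFactors.filter (fun p : ℕ => (p : ℤ) ∣ (f i).eval (r : ℤ)), Real.log p) / (((f i).natDegree : ℝ) * Real.log x) : ℝ) : ℂ) ^ (u - 1); let V : ℕ → ℝ := fun x => ∏ p ∈ (Finset.range ⌊(x : ℝ) ^ θ⌋₊).filter Nat.Prime, ((p : ℝ) - Literature.NumberTheory.Sieve.polyRootCountMod f p) / mabs p; (fun x : ℕ => ∑ d ∈ (Finset.Icc 1 ⌊(x : ℝ) ^ θ⌋₊).filter Squarefree, ∑ r ∈ (Finset.range d).filter (fun r : ℕ => (d : ℤ) ∣ ∏ i, (f i).eval (r : ℤ)), ‖A x d r - g d r * S x d r * ∑ n ∈ Finset.Icc 1 x, w n‖) =o[atTop] fun x : ℕ => (∑ n ∈ Finset.Icc 1 x, wabs n) * V x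

/-- `S⁺`: the complex-tilt strengthening for every Bateman–Horn system. -/
def TiltedLevelComplex : Prop :=
  ∀ (k : ℕ) (f : Fin k → Polynomial ℤ),
    Literature.NumberTheory.Sieve.IsBatemanHornSystem f → TiltedLevelComplexAt k f

/-- `S⁺ → crux` (routine specialisation `u = (z : ℂ)` plus cast bookkeeping; recorded as a Prop, not
proved in this census file). -/
def ComplexImpliesCrux : Prop :=
  TiltedLevelComplex → Summit.Parity.BatemanHorn.Theses.VanishingDimension.TiltedLevel

/-! ## Decomposition — within-pattern equidistribution ∧ pattern totals -/

/-- `WithinPattern` (parity-NEUTRAL piece), for ALL `θ ∈ (0, 1/4]`: inside each squarefree modulus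
`d ≤ x^θ`, root classes `r, r'` with the same local divisibility pattern
(`p ∣ f_i(r) ↔ p ∣ f_i(r')` for all `p ∣ d`, all `i`) carry the same tilted mass, in `ℓ¹` relative to
`A₁V`: `Σ_d Σ_r |A(x;d,r) - (Σ_{r' ~ r} A(x;d,r'))/#{r' ~ r}| = o(A₁ V)`. -/
def WithinPatternAt (k : ℕ) (f : Fin k → Polynomial ℤ) : Prop :=
  ∀ θ : ℝ, 0 < θ → θ ≤ 1 / 4 → ∃ z₀ : ℝ, 0 < z₀ ∧ ∀ z : ℝ, 0 < z → z < z₀ → let w : ℕ → ℝ := fun n => z ^ (∑ i, ArithmeticFunction.cardDistinctFactors (((f i).eval (n : ℤ)).toNat)); let A : ℕ → ℕ → ℕ → ℝ := fun x d r => ∑ n ∈ (Finset.Icc 1 x).filter (fun n : ℕ => n ≡ r [MOD d]), w n; let cnt : ℕ → ℕ → ℕ := fun p s => (Finset.univ.filter (fun i => (p : ℤ) ∣ (f i).eval (s : ℤ))).card; let m : ℕ → ℝ := fun p => ∑ s ∈ Finset.range p, z ^ cnt p s; let g : ℕ → ℕ → ℝ := fun d r => ∏ p ∈ d.primeFactors,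 z ^ cnt p r / m p; let S : ℕ → ℕ → ℕ → ℝ := fun x d r => ∏ i, (1 - (∑ p ∈ d.primeFactors.filter (fun p : ℕ => (p : ℤ) ∣ (f i).eval (r : ℤ)), Real.log p) / (((f i).natDegree : ℝ) * Real.log x)) ^ (z - 1); let V : ℕ → ℝ := fun x => ∏ p ∈ (Finset.range ⌊(x : ℝ) ^ θ⌋₊).filter Nat.Prime, ((p : ℝ) - Literature.NumberTheory.Sieve.polyRootCountMod f p) / m p; let P : ℕ → ℕ → Finset ℕ := fun d r => (Finset.range d).filter (fun r' : ℕ => (d : ℤ) ∣ ∏ i, (f i).eval (r' : ℤ) ∧ ∀ p ∈ d.primeFactors, ∀ i, ((p : ℤ) ∣ (f i).eval (r' : ℤ) ↔ (p : ℤ) ∣ (f i).eval (r : ℤ))); (fun x : ℕ => ∑ d ∈ (Finset.Icc 1 ⌊(x : ℝ) ^ θ⌋₊).filter Squarefree, ∑ r ∈ (Finset.range d).filter (fun r : ℕ => (d : ℤ) ∣ ∏ i, (f i).eval (r : ℤ)), |A x d r - (∑ r' ∈ P d r, A x d r') / ((P d r).card : ℝ)|) =o[atTop] fun x : ℕ =>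 (∑ n ∈ Finset.Icc 1 x, w n) * V x

/-- `PatternTotals` (parity-CARRYING piece): for some `θ ∈ (0,1/4]`, the total tilted mass of each
pattern class follows the model `#{r' ~ r} · g(d,r) S(x;d,r) A₁(x)` in `ℓ¹` relative to `A₁V`
(written per root class `r` with weight `1/#{r' ~ r}` to avoid quotienting by patterns). -/
def PatternTotalsAt (k : ℕ) (f : Fin k → Polynomial ℤ) : Prop :=
  ∃ θ : ℝ, 0 < θ ∧ θ ≤ 1 / 4 ∧ ∃ z₀ : ℝ, 0 < z₀ ∧ ∀ z : ℝ, 0 < z → z < z₀ → let w : ℕ → ℝ := fun n => z ^ (∑ i, ArithmeticFunction.cardDistinctFactors (((f i).eval (n : ℤ)).toNat)); let A : ℕ → ℕ → ℕ → ℝ := fun x d r => ∑ n ∈ (Finset.Icc 1 x).filter (fun n : ℕ => n ≡ r [MOD d]), w n; let cnt : ℕ → ℕ → ℕ := fun p s => (Finset.univ.filter (fun i => (p : ℤ) ∣ (f i).eval (s : ℤ))).card; let m : ℕ → ℝ := fun p => ∑ s ∈ Finset.range p, z ^ cnt p s; let g : ℕ → ℕ → ℝ := fun d r => ∏ p ∈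 d.primeFactors, z ^ cnt p r / m p; let S : ℕ → ℕ → ℕ → ℝ := fun x d r => ∏ i, (1 - (∑ p ∈ d.primeFactors.filter (fun p : ℕ => (p : ℤ) ∣ (f i).eval (r : ℤ)), Real.log p) / (((f i).natDegree : ℝ) * Real.log x)) ^ (z - 1); let V : ℕ → ℝ := fun x => ∏ p ∈ (Finset.range ⌊(x : ℝ) ^ θ⌋₊).filter Nat.Prime, ((p : ℝ) - Literature.NumberTheory.Sieve.polyRootCountMod f p) / m p; let P : ℕ → ℕ → Finset ℕ := fun d r => (Finset.range d).filter (fun r' : ℕ => (d : ℤ) ∣ ∏ i, (f i).eval (r' : ℤ) ∧ ∀ p ∈ d.primeFactors, ∀ i, ((p : ℤ) ∣ (f i).eval (r' : ℤ) ↔ (p : ℤ) ∣ (f i).eval (r : ℤ))); (fun x : ℕ => ∑ d ∈ (Finset.Icc 1 ⌊(x : ℝ) ^ θ⌋₊).filter Squarefree, ∑ r ∈ (Finset.range d).filter (fun r : ℕ => (d : ℤ) ∣ ∏ i, (f i).eval (r : ℤ)), (1 / ((P d r).card : ℝ)) * |(∑ r' ∈ P d r, A x d r') - ((P d r).card : ℝ)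 * (g d r * S x d r * ∑ n ∈ Finset.Icc 1 x, w n)|) =o[atTop] fun x : ℕ => (∑ n ∈ Finset.Icc 1 x, w n) * V x

/-- `WithinPattern` for every system. -/
def WithinPattern : Prop :=
  ∀ (k : ℕ) (f : Fin k → Polynomial ℤ),
    Literature.NumberTheory.Sieve.IsBatemanHornSystem f → WithinPatternAt k f

/-- `PatternTotals` for every system. -/
def PatternTotals : Prop :=
  ∀ (k : ℕ) (f : Fin k → Polynomial ℤ),
    Literature.NumberTheory.Sieve.IsBatemanHornSystem f → PatternTotalsAt k f

/-- The glue of the best typed split (termwise triangle inequality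
`|A - gSA₁| ≤ |A - T/N| + (1/N)|T - N·gSA₁|`, `N ≥ 1` because `r ~ r`, then `IsLittleO.add`);
recorded as a Prop — the split is NOT filed (census §Decomposition: `PatternTotals` keeps the whole
parity content of the crux, `WithinPattern` is relative-Chowla-hard for every non-linear member). -/
def SplitGlue : Prop :=
  WithinPattern → PatternTotals → Summit.Parity.BatemanHorn.Theses.VanishingDimension.TiltedLevel

end Summit.Parity.BatemanHorn.Cruxes.TiltedLevel.Census
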